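import Summits.FinalStateConjecture.FinalStateConjecture.Theorems.StarvedNecksHonestFixedRadiusSettlingSheetBurialOwes
import Summits.FinalStateConjecture.FinalStateConjecture.Theorems.SwallowTheDatumParametricKerrBurialStubUnitGluingReduction
import Summits.FinalStateConjecture.FinalStateConjecture.Theorems.SwallowTheDatumParametricKerrBurialStubChargeBound
import Summits.FinalStateConjecture.FinalStateConjecture.Theorems.SwallowTheDatumParametricKerrBurialStubFarGluingOfUnitGluing
import Summits.FinalStateConjecture.FinalStateConjecture.Theorems.SwallowTheDatumUniversalWitnessFamilyStubModelData
import Summits.FinalStateConjecture.FinalStateConjecture.Theorems.SwallowTheDatumUniversalWitnessFamilyStubSchwOutSite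
import HarnessLib

/-!
# Crux `StarvedNecks.HonestFixedRadiusSettling` (stmt-FinalStateConjecture-13550), line `far-field-surgery`
# (sheet burial): the crux from ONE unprinted atom and ONE published theorem

Lead c4, 2026-08-16.  The landed sheet-burial composition (`…SheetBurialLine.lean`, `…SheetBurialOwes.lean`) closes the
crux modulo the SwallowTheDatum items `FarAnnulusGluing` (15427), `UniversalSocketBag` (15426), `MGHDExists` (9937) and
`SubdataDevelopmentsEmbed` (10053), displayed there as `choquetBruhat_geroch_exists_mghd_cauchy → FarAnnulusGluing →
ObstructionFreeAnnularGluing → (bulk) → HonestFixedRadiusSettling`.  This file sharpens the display to the programme's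
single unprinted atom: the POSITED parametric Mao–Oh–Tao gluing `∀ η, IsBump η → GluingFamilyFor η` (crux 10052's registered
`stub_gluingFamily`; Mao–Oh–Tao print Thm 1.7 with local LIPSCHITZ dependence, Rem 1.9, not joint `C^∞` dependence on a
parameter of the in-data).

* `farAnnulusGluing_of_gluingFamily` — item 15427 BY NAME from the atom alone: the composition of crux 10052's LANDED
  A-side theorems (`stub_endChartDatum`, `stub_unitAnnulusGluing_of_gluingFamily`, `stub_chargeBound`,
  `stub_endRescaling_of_chartDatum`, `stub_farGluing_of_unitGluing`) with crux 10051's landed `stub_modelData` /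
  `stub_schwOutSite`; kernel-checked here for the first time under `Theorems/` (it existed only in 10052's crux workfile).
* the printed Thm 1.7 (`ObstructionFreeAnnularGluing`, a named fact) is the atom at a CONSTANT family, so it is not an
  independent hypothesis;
* `honestFixedRadiusSettling_of_choquetBruhatGeroch_of_gluingFamily_of_bulkAt` — the crux from the Choquet-Bruhat–Geroch
  theorem (named fact), the atom, and the explicit Brill–Lindquist bulk hypothesis of `…SheetBurialOwes` (being discharged by
  crux 10052's `stub_bulkAt`).

CONDITIONAL (hypotheses are named statements); credits nothing by itself; no new definition.
-/

set_option linter.dupNamespace false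

noncomputable section

namespace Summit.FinalStateConjecture.FinalStateConjecture.Theorems.StarvedNecks.SheetBurial

open scoped Manifold ContDiff Topology
open Set Literature.Geometry.Lorentzian Literature.Geometry.Lorentzian.MaoOhTao
open Summit.FinalStateConjecture.FinalStateConjecture.Theses.StarvedNecks (HonestFixedRadiusSettling)
open Summit.FinalStateConjecture.FinalStateConjecture.Theses.SwallowTheDatum (FarAnnulusGluing)
open Summit.FinalStateConjecture.FinalStateConjecture.Theorems.SwallowTheDatum.ParametricKerrBurial
open Summit.FinalStateConjecture.FinalStateConjecture.Theorems.SwallowTheDatum.UniversalWitnessFamily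
  (stub_modelData stub_schwOutSite)

/-- The coordinate reading `coordH` of a datum on `ℝ³` is `C^∞` (from `contMDiff_coordH`). [folklore] -/
private theorem contDiff_coordH_aux (D : InitialDataSet (𝓡 3) E3) : ContDiff ℝ ∞ D.coordH :=
  D.contMDiff_coordH.contDiff

/-- The coordinate reading `coordK` of a datum on `ℝ³` is `C^∞` (from `contMDiff_coordK`). [folklore] -/
private theorem contDiff_coordK_aux (D : InitialDataSet (𝓡 3) E3) : ContDiff ℝ ∞ D.coordK :=
  D.contMDiff_coordK.contDiff

/-- **The printed gluing theorem is the atom at a constant family**: `GluingFamilyFor η` applied to the constant in-family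
`t ↦ Din` (jointly smooth because `Din.coordH`, `Din.coordK` are) returns Mao–Oh–Tao Thm 1.7 for the pair `(Din, Dout)`.
(Local copy of the same observation in crux 10052's workfile `Lines/receding_annulus_universal_collar.lean`.)
[cite: MaoOhTao2023, Thm 1.7] -/
private theorem obstructionFreeAnnularGluing_of_gluingFamily_aux
    (hG : ∀ η : ℝ → ℝ, IsBump η → GluingFamilyFor η) : ObstructionFreeAnnularGluing := by
  intro η hη
  obtain ⟨εo, μo, hεo, hμo, h⟩ := hG η hη
  refine ⟨εo, μo, hεo, hμo, fun Din Dout sIn sOut hvin hvout hdin hdout h1 h2 h3 h4 h5 ↦ ?_⟩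
  have hH : ContDiffOn ℝ ∞ (fun p : ℝ × E3 ↦ Din.coordH p.2) ({t | (0 : ℝ) < t} ×ˢ univ) :=
    ((contDiff_coordH_aux Din).comp contDiff_snd).contDiffOn
  have hK : ContDiffOn ℝ ∞ (fun p : ℝ × E3 ↦ Din.coordK p.2) ({t | (0 : ℝ) < t} ×ˢ univ) :=
    ((contDiff_coordK_aux Din).comp contDiff_snd).contDiffOn
  obtain ⟨D, -, -, hD⟩ := h 0 (fun _ ↦ Din) Dout (fun _ ↦ sIn) sOut hH hK hvout
    (fun t _ ↦ ⟨hvin, hdin, hdout, h1, h2, h3, h4, h5⟩)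
  exact ⟨D 1, hD 1 one_pos⟩

/-- **Item `FarAnnulusGluing` (stmt-FinalStateConjecture-15427) from the atom alone.**  For `d ∈ 𝓓(X)`: read the sole
Dafermos–Rodnianski end in its chart (`stub_endChartDatum`), rescale to unit scale with `C² × C¹`-smallness beyond `R⋆`
(`stub_endRescaling_of_chartDatum`), glue parametrically at unit scale onto exterior isotropic Schwarzschild(`η`)
(`stub_unitAnnulusGluing_of_gluingFamily`, fed by the atom, the Schwarzschild model datum and OUT-site `stub_modelData.2` /
`stub_schwOutSite`, and the charge bound `stub_chargeBound`), and dilate–transport–patch back (`stub_farGluing_of_unitGluing`).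
All five ingredients are landed theorems of cruxes 10052/10051; the statement is the Theses item verbatim (its vocabulary
`SmoothSectionsOn` / `AgreeAt` / `IsExactSchwarzschildBeyond` unfolds definitionally). [cite: MaoOhTao2023, Thm 1.7, Rem 1.9]
[cite: Corvino2000, §4] -/
theorem farAnnulusGluing_of_gluingFamily :
    (∀ η : ℝ → ℝ, IsBump η → GluingFamilyFor η) → FarAnnulusGluing := by
  intro hG X _ _ _ _ _ _ d hd
  obtain ⟨e, M, I₀, hsole, hDR, hvac, hread⟩ := stub_endChartDatum X d hd
  obtain ⟨η, δ₀, hη, hδ₀, hunit⟩ :=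
    stub_unitAnnulusGluing_of_gluingFamily hG stub_modelData.2 stub_schwOutSite stub_chargeBound
  obtain ⟨Rstar, I, heR, h1, hIs, hIvac, hIread, hIsmall⟩ :=
    stub_endRescaling_of_chartDatum X d e M I₀ hDR hvac hread δ₀ hδ₀
  obtain ⟨O, hOs, hO⟩ := hunit Rstar I hIs hIvac hIsmall
  obtain ⟨m, G, hm, hGs, hG'⟩ :=
    stub_farGluing_of_unitGluing X d e Rstar η I O hd hsole heR h1 hη hIread hOs hO
  exact ⟨η, e, Rstar, m, G, hη, hsole, heR, hm, hGs, hG'⟩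

/-- **The crux from the Choquet-Bruhat–Geroch theorem, the ONE unprinted atom, and the bulk.**  `FarAnnulusGluing` is
`farAnnulusGluing_of_gluingFamily`, the printed Mao–Oh–Tao Thm 1.7 is the atom at a constant family, and the rest is the landed
`honestFixedRadiusSettling_of_choquetBruhatGeroch_of_farGluing_of_bulkAt`.  CONDITIONAL display; credits nothing by itself.
[cite: ChoquetBruhatGeroch1969CMP, Thm. 3] [cite: MaoOhTao2023, Thm 1.7, Rem 1.9] [cite: DafermosLuk2017, Conjecture 1] -/
theorem honestFixedRadiusSettling_of_choquetBruhatGeroch_of_gluingFamily_of_bulkAt :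
    choquetBruhat_geroch_exists_mghd_cauchy → (∀ η : ℝ → ℝ, IsBump η → GluingFamilyFor η) →
    (∀ η : ℝ → ℝ, IsBump η → ∀ (εo μo M : ℝ), 0 < εo → 0 < μo → 0 < M →
      ∃ μ'₀ : ℝ, 0 < μ'₀ ∧ ∀ μ' : ℝ, 0 < μ' → μ' ≤ μ'₀ → BulkAt η εo μo M μ') →
    HonestFixedRadiusSettling :=
  fun hcbg hG hBulk ↦
    honestFixedRadiusSettling_of_choquetBruhatGeroch_of_farGluing_of_bulkAt hcbg (farAnnulusGluing_of_gluingFamily hG)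
      (obstructionFreeAnnularGluing_of_gluingFamily_aux hG) hBulk

end Summit.FinalStateConjecture.FinalStateConjecture.Theorems.StarvedNecks.SheetBurial

end
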